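import Summits.QuantumFields.BalabanUV.Beta.RemainderExplicitHistoryLogMomentSharp

/-!
# RemainderExplicitHistoryHalfMomentWitness — ROAD P3: THE ORDER-0 FAMILY `β_{k+1} = b + Σ_{i≤k} λ k i·min(g_k, |g_k − g_i|)` —
# node U2's `HistLipschitz` with the weights `λ` (plus the total `W` on the last variable), (AF-1), a two-loop FREE diagonal, runs;
# along a run its remainder is `Σ_i λ k i·(g_k − g_i) ≥ Σ_i λ k i·g_k·min(1, (k − i)·b₀·g_k²)∕4`; and the lower SQUARE-ROOT sum
# `Σ_{m<a} 1∕√(P + c(m+1)) ≥ (2∕c)(√(P + c(a+1)) − √(P + c))` — the objects of the order-0 half of station S-d4p3-g44-1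
# (`RemainderExplicitHistoryHalfMomentSharp` draws the conclusion for the PROFILE case `λ k i = ρ(k − i)`)

Cell `pub-balaban`, β-function sub-cell, BINDER row D4 «RemainderConst leaves for Bałaban's split» (`HOME/BINDER-OWNERS.md`; owner
lineage `b2b-balaban-beta-an4`; this file by co-owner #3 lineage `b2b-balaban-beta-d4-p3`, road P3 «the reduction road», generation 44,
station S-d4p3-g44-1, first file; imports `RemainderExplicitHistoryLogMomentSharp` for the LOWER run geometry of
`RemainderExplicitHistoryLogMomentWitness` (`run_sub_ge`, `run_sq_ge`, `sum_profile_le`) and `deviation_eq`), β-FLOW TEAM duty (1);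
FREEZE (0) honoured (def-free module in road P3's own `RemainderExplicit*` series; no leaf, no interface, no Literature file).  SOURCE
OF THE SHAPES ONLY: [Balaban1987RG1] (0.20) p. 256, (0.31) and Thm 2 p. 259, (2.12)–(2.14) p. 268, §1 p. 264, §5 p. 298.  Pure real
analysis about ONE explicit toy family (ours, not Bałaban's).

HONEST FRAMING (page 1 of everything the β sub-cell writes).  *"Discharging BetaPertH makes Bałaban's UV stability UNCONDITIONAL —
a real constructive-QFT result; it is NOT the continuum limit and NOT the Clay problem."*  THIS FILE DISCHARGES NOTHING OF THE
KIND.  It is elementary bookkeeping about the ORDER-0 FAMILY `β_{k+1}(g_0,…,g_k) = b + Σ_{i≤k} λ k i·min(g_k, |g_k − g_i|)` (`b > 0`,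
weights `λ k i ≥ 0` with `Σ_i λ k i ≤ W`, box smallness `2Wγ ≤ b`; PROFILE case `λ k i = ρ(k − i)`), carried as a HYPOTHESIS `hβ` on an
abstract `β : FlowStep.HBeta` (def-free).  The `min` with `g_k` is what makes the history term vanish at `g_k = 0` (a PRINTED split with
one-loop part `b`, (AF-1) with `C₁ = W`) WITHOUT the factor `g_k` of the order-(AF-1) family of `RemainderExplicitHistoryLogMomentWitness`:
the family carries node U2's ORDER-0 modulus `HistLipschitz Λ γ β` ([Balaban1987RG1] p. 298 names the dependence on the preceding
couplings, no modulus is printed) with `Λ k i = λ k i + [i = k]·W`, and NOT the order-(AF-1) modulus with bounded weights.  Along a run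
of (0.20) the `min` resolves (`0 < g_i ≤ g_k`): the remainder is `Σ_i λ k i·(g_k − g_i)`, ONE power of `g_k` below the order-(AF-1)
family's.  Nothing of Bałaban's (1.22) is asserted or constructed; row D4 class UNCHANGED (critical-path width 0; instance 0∕1; D4
DISCHARGE NO DATE); NOT B12 Thm 2, NOT BetaPertH, NOT continuum, NOT Clay.  HONEST DEPENDENCY: continuum YM on T⁴ ⇐ BetaPertH ∧
nine spine estimates (0/9 proved); BetaPertH ⇐ (D1) ∧ (D4) ∧ CAP+tail; G-an2-4 gates asym, D1 and NE2/3/4.  ABSOLUTE RULE: nothing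
is cited as a fact.

WHAT IS PROVED ([folklore]; 0 sorry; 0 `def`; all for GENERAL weights `λ k i ≥ 0`, `Σ_i λ k i ≤ W`).
* §1 THE FAMILY: `abs_min_abs_sub_le` (`|min(a,|a − x|) − min(a′,|a′ − x′|)| ≤ |a − a′| + |x − x′|`), `hist_nonneg` ∕ `hist_le`
  (`0 ≤ Σ_i λ k i·min(p_k,|p_k − p_i|) ≤ W·p_k` on the box), `exists_split` ∕ `β1_eq` (printed split with one-loop part `b`),
  `diagTL_zero` (the diagonal obeys (TL) with `β¹¹_∞ = C₃ = c₁ = 0`), `af1` (`|β¹| ≤ W·p_k`), `lower` ∕ `upper` (`b ≤ β ≤ 3b∕2`),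
  **`histLipschitz`** (node U2's ORDER-0 modulus with `Λ k i = λ k i + [i = k]·W`), `continuousOn`, `runs_exist`
  (`FlowStep.couplingTrajectory_exists_history` BY NAME).
* §2 ALONG A RUN: `beta1_prefix_eq` (`β¹_k(prefix) = Σ_i λ k i·(g_k − g_i)`: the `min` resolves by (E30)'s `run_mono`),
  **`beta1_prefix_ge`** (`β¹_k(prefix) ≥ Σ_i λ k i·g_k·min(1, (k − i)·b₀·g_k²)∕4`, the order-(AF-1) witness file's `run_sub_ge`
  termwise — ONE power of `g_k` where that file has two), `beta1_prefix_ge_profile` (PROFILE case, the Fin-sum reflected to ages: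
  `β¹_k(prefix) ≥ (g_k∕4)·Σ_{a<k+1} ρ(a)·min(1, a·b₀·g_k²)`).
* §3 THE LOWER SQUARE-ROOT SUM: `two_div_mul_sqrt_sub_le` (`(2∕c)(√(x + c) − √x) ≤ 1∕√x`), **`sum_inv_sqrt_add_mul_ge`**
  (`(2∕c)(√(P + c(a+1)) − √(P + c)) ≤ Σ_{m<a} 1∕√(P + c(m+1))`, telescoped).
* §4 `not_orderOneMemory`: the family is GENUINELY order 0 — if some weight off the last variable is positive (`λ k i₀ > 0`, `i₀ ≠ k`)
  then for every `W′` there are `p, q` in the box with `p_k = q_k` and `|β(p) − β(q)| > p_k·W′·Σ_i |p_i − q_i|` (witness: last coupling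
  `ε`, the coupling `i₀` equal to `ε∕2` in `p` and to `ε` in `q`), so (M11) of `RemainderExplicitHistoryLogMoment` fails for every weight
  family bounded by `W′` — the order-(AF-1) threshold files do not govern this family.
All letters NOT-IN-PRINT; `BetaFlowAsPrinted S` records a Markov β_n only ⇒ no junction of the as-printed interface changes.
-/

noncomputable section

open Finset Filter Topology

namespace Summit.QuantumFields.BalabanUV.Beta.RemainderExplicitHistoryHalfMomentWitness

open Literature.MathematicalPhysics.QuantumFieldTheory.Balaban1983to89
open Literature.MathematicalPhysics.QuantumFieldTheory.Balaban1983to89.FlowStep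
open Literature.MathematicalPhysics.QuantumFieldTheory.Balaban1983to89.T4CouplingMatching
open Summit.QuantumFields.BalabanUV.Beta.EriceRemainderEnclosureHistoryJunction (abs_sub_le_of_mem_Ioc)
open Summit.QuantumFields.BalabanUV.Beta.EriceRemainderEnclosureHistoryTwoLoop
open Summit.QuantumFields.BalabanUV.Beta.RemainderExplicitHistoryLogMomentWitness (sum_profile_le run_sub_ge run_sq_ge)

variable {β : HBeta} {b γ W : ℝ} {lam : ℕ → ℕ → ℝ} {ρ : ℕ → ℝ}

/-! ## §1 The family `β_{k+1}(p) = b + Σ_{i≤k} λ k i·min(p_k, |p_k − p_i|)`, weights `λ k i ≥ 0`, `Σ_i λ k i ≤ W` (a hypothesis on an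
abstract `β`; the PROFILE case is `λ k i = ρ(k − i)`) -/

/-- THE ONE-TERM MODULUS: `|min(a, |a − x|) − min(a′, |a′ − x′|)| ≤ |a − a′| + |x − x′|` (Mathlib's `abs_min_sub_min_le_max` and
`abs_abs_sub_abs_le_abs_sub`). [folklore] -/
theorem abs_min_abs_sub_le (a x a' x' : ℝ) : |min a (|a - x|) - min a' (|a' - x'|)| ≤ |a - a'| + |x - x'| := by
  refine (abs_min_sub_min_le_max a (|a - x|) a' (|a' - x'|)).trans (max_le ?_ ?_)
  · linarith [abs_nonneg (x - x')]
  · calc |(|a - x|) - (|a' - x'|)| ≤ |a - x - (a' - x')| := abs_abs_sub_abs_le_abs_sub _ _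
      _ = |a - a' - (x - x')| := by ring_nf
      _ ≤ |a - a'| + |x - x'| := abs_sub _ _

/-- Each history term is between `0` and `p_k` on the box: `0 ≤ min(p_k, |p_k − p_i|) ≤ p_k`. [folklore] -/
theorem term_nonneg_le {k : ℕ} {p : Fin (k + 1) → ℝ} (hp : p ∈ Box γ k) (i : Fin (k + 1)) :
    0 ≤ min (p (Fin.last k)) (|p (Fin.last k) - p i|) ∧ min (p (Fin.last k)) (|p (Fin.last k) - p i|) ≤ p (Fin.last k) :=
  ⟨le_min (mem_box.1 hp _).1.le (abs_nonneg _), min_le_left _ _⟩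

/-- THE HISTORY TERM IS NON-NEGATIVE on the box (`λ ≥ 0`). [folklore] -/
theorem hist_nonneg (hlam0 : ∀ (k : ℕ) (i : Fin (k + 1)), 0 ≤ lam k i) {k : ℕ} {p : Fin (k + 1) → ℝ} (hp : p ∈ Box γ k) :
    0 ≤ ∑ i : Fin (k + 1), lam k i * min (p (Fin.last k)) (|p (Fin.last k) - p i|) :=
  sum_nonneg fun i _ => mul_nonneg (hlam0 _ _) (term_nonneg_le hp i).1

/-- THE HISTORY TERM IS AT MOST `W·p_k` on the box (`λ ≥ 0`, `Σ_i λ k i ≤ W`). [folklore] -/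
theorem hist_le (hlam0 : ∀ (k : ℕ) (i : Fin (k + 1)), 0 ≤ lam k i) (hlamW : ∀ k, ∑ i : Fin (k + 1), lam k i ≤ W)
    {k : ℕ} {p : Fin (k + 1) → ℝ} (hp : p ∈ Box γ k) :
    ∑ i : Fin (k + 1), lam k i * min (p (Fin.last k)) (|p (Fin.last k) - p i|) ≤ W * p (Fin.last k) := by
  have hk := (mem_box.1 hp (Fin.last k)).1
  calc ∑ i : Fin (k + 1), lam k i * min (p (Fin.last k)) (|p (Fin.last k) - p i|)
      ≤ ∑ i : Fin (k + 1), lam k i * p (Fin.last k) :=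
        sum_le_sum fun i _ => mul_le_mul_of_nonneg_left (term_nonneg_le hp i).2 (hlam0 _ _)
    _ = (∑ i : Fin (k + 1), lam k i) * p (Fin.last k) := by rw [sum_mul]
    _ ≤ W * p (Fin.last k) := mul_le_mul_of_nonneg_right (hlamW k) hk.le

/-- A PRINTED split of the family with one-loop part `b` exists: the history term VANISHES at `p_k = 0` because of the `min` with
`p_k` (no factor `p_k` is needed). [cite: Balaban1987RG1, (2.12)–(2.14) p.268] -/
theorem exists_split
    (hβ : ∀ (k : ℕ) (p : Fin (k + 1) → ℝ),
      β k p = b + ∑ i : Fin (k + 1), lam k i * min (p (Fin.last k)) (|p (Fin.last k) - p i|)) :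
    ∃ S : B12Beta.OneLoopSplit β, ∀ k, S.β0 k = b :=
  ⟨⟨fun _ => b, fun k p => ∑ i : Fin (k + 1), lam k i * min (p (Fin.last k)) (|p (Fin.last k) - p i|), fun k p => hβ k p,
    fun k p hp => by
      refine sum_eq_zero fun i _ => ?_
      rw [hp, min_eq_left (abs_nonneg _), mul_zero]⟩, fun _ => rfl⟩

/-- Every split with one-loop part `b` has remainder `β¹ = Σ_i λ k i·min(p_k, |p_k − p_i|)`. [folklore] -/
theorem β1_eq
    (hβ : ∀ (k : ℕ) (p : Fin (k + 1) → ℝ),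
      β k p = b + ∑ i : Fin (k + 1), lam k i * min (p (Fin.last k)) (|p (Fin.last k) - p i|))
    (S : B12Beta.OneLoopSplit β) (hS : ∀ k, S.β0 k = b) (k : ℕ) (p : Fin (k + 1) → ℝ) :
    S.β1 k p = ∑ i : Fin (k + 1), lam k i * min (p (Fin.last k)) (|p (Fin.last k) - p i|) := by
  have h := S.split k p
  rw [hS k, hβ k p] at h
  linarith

/-- THE DIAGONAL IS TWO-LOOP FREE: on constant histories every `min(x, |x − x|) = 0`, so `β¹ = 0` — node U2's (TL) with
`β¹¹_∞ = C₃ = c₁ = 0`. [folklore] -/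
theorem diagTL_zero
    (hβ : ∀ (k : ℕ) (p : Fin (k + 1) → ℝ),
      β k p = b + ∑ i : Fin (k + 1), lam k i * min (p (Fin.last k)) (|p (Fin.last k) - p i|))
    (S : B12Beta.OneLoopSplit β) (hS : ∀ k, S.β0 k = b) (k : ℕ) (x : ℝ) (hx : 0 < x) (_hxγ : x ≤ γ) :
    |S.β1 k (fun _ : Fin (k + 1) => x) - 0 * x ^ 2| ≤ 0 * x ^ 3 + 0 * (0 : ℝ) ^ k := by
  rw [β1_eq hβ S hS]
  simp [min_eq_right hx.le]

/-- (AF-1) for the family: `|β¹(p)| ≤ W·p_k` on the boxes. [folklore] -/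
theorem af1
    (hβ : ∀ (k : ℕ) (p : Fin (k + 1) → ℝ),
      β k p = b + ∑ i : Fin (k + 1), lam k i * min (p (Fin.last k)) (|p (Fin.last k) - p i|))
    (S : B12Beta.OneLoopSplit β) (hS : ∀ k, S.β0 k = b) (hlam0 : ∀ (k : ℕ) (i : Fin (k + 1)), 0 ≤ lam k i)
    (hlamW : ∀ k, ∑ i : Fin (k + 1), lam k i ≤ W)
    (k : ℕ) (p : Fin (k + 1) → ℝ) (hp : p ∈ Box γ k) : |S.β1 k p| ≤ W * p (Fin.last k) := by
  rw [β1_eq hβ S hS, abs_of_nonneg (hist_nonneg hlam0 hp)]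
  exact hist_le hlam0 hlamW hp

/-- LOWER bound on the boxes: `b ≤ β` (the history term is non-negative). [folklore] -/
theorem lower
    (hβ : ∀ (k : ℕ) (p : Fin (k + 1) → ℝ),
      β k p = b + ∑ i : Fin (k + 1), lam k i * min (p (Fin.last k)) (|p (Fin.last k) - p i|))
    (hlam0 : ∀ (k : ℕ) (i : Fin (k + 1)), 0 ≤ lam k i) (k : ℕ) (p : Fin (k + 1) → ℝ) (hp : p ∈ Box γ k) : b ≤ β k p := by
  rw [hβ k p]
  linarith [hist_nonneg (k := k) hlam0 hp]

/-- UPPER bound on the boxes: `β ≤ 3b∕2` when `2Wγ ≤ b` (the history term is at most `W·p_k ≤ Wγ`). [folklore] -/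
theorem upper
    (hβ : ∀ (k : ℕ) (p : Fin (k + 1) → ℝ),
      β k p = b + ∑ i : Fin (k + 1), lam k i * min (p (Fin.last k)) (|p (Fin.last k) - p i|))
    (hlam0 : ∀ (k : ℕ) (i : Fin (k + 1)), 0 ≤ lam k i) (hlamW : ∀ k, ∑ i : Fin (k + 1), lam k i ≤ W) (hsmall : 2 * W * γ ≤ b)
    (k : ℕ) (p : Fin (k + 1) → ℝ) (hp : p ∈ Box γ k) : β k p ≤ 3 * b / 2 := by
  rw [hβ k p]
  have hk := mem_box.1 hp (Fin.last k)
  have hW0 : 0 ≤ W := le_trans (sum_nonneg fun i _ => hlam0 0 i) (hlamW 0)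
  have h := hist_le hlam0 hlamW hp
  have : W * p (Fin.last k) ≤ W * γ := mul_le_mul_of_nonneg_left hk.2 hW0
  linarith

/-- **THE FAMILY HAS NODE U2's ORDER-0 MODULUS** `HistLipschitz Λ γ β` with `Λ k i = λ k i + [i = k]·W` (`λ ≥ 0`, `Σ_i λ k i ≤ W`): for
ALL `p, q` in the box (no `p_k = q_k` clause, no factor `p_k`), `|β(p) − β(q)| ≤ Σ_i (λ k i + [i = k]·W)·|p_i − q_i|` — each term moves
by at most `λ k i·(|p_k − q_k| + |p_i − q_i|)` (`abs_min_abs_sub_le`). [cite: Balaban1987RG1, §5 p.298 and §1 p.264] -/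
theorem histLipschitz
    (hβ : ∀ (k : ℕ) (p : Fin (k + 1) → ℝ),
      β k p = b + ∑ i : Fin (k + 1), lam k i * min (p (Fin.last k)) (|p (Fin.last k) - p i|))
    (hlam0 : ∀ (k : ℕ) (i : Fin (k + 1)), 0 ≤ lam k i) (hlamW : ∀ k, ∑ i : Fin (k + 1), lam k i ≤ W) :
    HistLipschitz (fun k i => lam k i + if i = k then W else 0) γ β := by
  intro k p q _hp _hq
  have e : β k p - β k q = ∑ i : Fin (k + 1), lam k i *
      (min (p (Fin.last k)) (|p (Fin.last k) - p i|) - min (q (Fin.last k)) (|q (Fin.last k) - q i|)) := by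
    rw [hβ k p, hβ k q, add_sub_add_left_eq_sub, ← sum_sub_distrib]
    exact sum_congr rfl fun i _ => by ring
  rw [e]
  -- termwise modulus
  have h1 : |∑ i : Fin (k + 1), lam k i *
      (min (p (Fin.last k)) (|p (Fin.last k) - p i|) - min (q (Fin.last k)) (|q (Fin.last k) - q i|))| ≤
      ∑ i : Fin (k + 1), lam k i * (|p (Fin.last k) - q (Fin.last k)| + |p i - q i|) := by
    refine (abs_sum_le_sum_abs _ _).trans (sum_le_sum fun i _ => ?_)
    rw [abs_mul, abs_of_nonneg (hlam0 _ _)]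
    exact mul_le_mul_of_nonneg_left (abs_min_abs_sub_le _ _ _ _) (hlam0 _ _)
  refine h1.trans ?_
  -- split the bound: (Σ λ)·|p_k − q_k| + Σ λ·|p_i − q_i| ≤ W·|p_k − q_k| + Σ λ·|p_i − q_i|
  have hsplit : ∑ i : Fin (k + 1), lam k i * (|p (Fin.last k) - q (Fin.last k)| + |p i - q i|) =
      (∑ i : Fin (k + 1), lam k i) * |p (Fin.last k) - q (Fin.last k)| + ∑ i : Fin (k + 1), lam k i * |p i - q i| := by
    rw [sum_mul, ← sum_add_distrib]
    exact sum_congr rfl fun i _ => by ring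
  have htarget : ∑ i : Fin (k + 1), (lam k i + if ((i : ℕ)) = k then W else 0) * |p i - q i| =
      ∑ i : Fin (k + 1), lam k i * |p i - q i| + W * |p (Fin.last k) - q (Fin.last k)| := by
    have e2 : ∀ i : Fin (k + 1), (lam k i + if ((i : ℕ)) = k then W else 0) * |p i - q i| =
        lam k i * |p i - q i| + if i = Fin.last k then W * |p i - q i| else 0 := by
      intro i
      have hiff : ((i : ℕ) = k) ↔ i = Fin.last k := by
        rw [Fin.ext_iff, Fin.val_last]
      by_cases hc : i = Fin.last k
      · rw [if_pos (hiff.2 hc), if_pos hc]; ring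
      · rw [if_neg (mt hiff.1 hc), if_neg hc]; ring
    rw [sum_congr rfl fun i _ => e2 i, sum_add_distrib, sum_ite_eq' univ (Fin.last k)]
    simp
  rw [hsplit, htarget]
  have hW0 := hlamW k
  nlinarith [abs_nonneg (p (Fin.last k) - q (Fin.last k))]

/-- Each `β k` is continuous (sums, products, `min` and `|·|` of coordinates), in particular on the box. [folklore] -/
theorem continuousOn
    (hβ : ∀ (k : ℕ) (p : Fin (k + 1) → ℝ),
      β k p = b + ∑ i : Fin (k + 1), lam k i * min (p (Fin.last k)) (|p (Fin.last k) - p i|))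
    (k : ℕ) : ContinuousOn (β k) (Box γ k) := by
  have e : β k = fun p => b + ∑ i : Fin (k + 1), lam k i * min (p (Fin.last k)) (|p (Fin.last k) - p i|) :=
    funext (hβ k)
  rw [e]
  fun_prop

/-- **THE RUNS EXIST** (`FlowStep.couplingTrajectory_exists_history` from continuity and `b ≤ β ≤ 3b∕2` on the boxes): for every `K`
and every renormalized `g ∈ ]0,γ]` a solution of (0.20) in the box ending at `gs K = g`. [cite: Balaban1987RG1, Thm 2 p.259] -/
theorem runs_exist
    (hβ : ∀ (k : ℕ) (p : Fin (k + 1) → ℝ),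
      β k p = b + ∑ i : Fin (k + 1), lam k i * min (p (Fin.last k)) (|p (Fin.last k) - p i|))
    (hb : 0 < b) (hlam0 : ∀ (k : ℕ) (i : Fin (k + 1)), 0 ≤ lam k i) (hlamW : ∀ k, ∑ i : Fin (k + 1), lam k i ≤ W) (hγ : 0 < γ)
    (hsmall : 2 * W * γ ≤ b) (K : ℕ) {g : ℝ} (hg : 0 < g) (hgγ : g ≤ γ) :
    ∃ gs : ℕ → ℝ, gs K = g ∧ RGEqH K β gs ∧ ∀ k, k ≤ K → 0 < gs k ∧ gs k ≤ γ := by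
  obtain ⟨gs, hK, hrg, hbox, -⟩ := couplingTrajectory_exists_history β hγ hb (by linarith : b ≤ 3 * b / 2)
    (continuousOn hβ) (lower hβ hlam0) (upper hβ hlam0 hlamW hsmall) K g hg hgγ
  exact ⟨gs, hK, hrg, hbox⟩

/-! ## §2 Along a run: the `min` resolves and the remainder is one power of `g_k` below the order-(AF-1) family's -/

/-- **ALONG A RUN THE `min` RESOLVES**: with `β ≥ b₀ > 0` along the run the couplings increase ((E30)'s `run_mono`), so
`0 < g_i ≤ g_k` and `min(g_k, |g_k − g_i|) = g_k − g_i`: `β¹_k(prefix) = Σ_i λ k i·(g_k − g_i)`. [folklore] -/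
theorem beta1_prefix_eq
    (hβ : ∀ (k : ℕ) (p : Fin (k + 1) → ℝ),
      β k p = b + ∑ i : Fin (k + 1), lam k i * min (p (Fin.last k)) (|p (Fin.last k) - p i|))
    (S : B12Beta.OneLoopSplit β) (hS : ∀ k, S.β0 k = b) {K : ℕ} {gs : ℕ → ℝ} {b₀ : ℝ}
    (h : RGEqH K β gs) (hpos : ∀ k, k ≤ K → 0 < gs k) (hb₀ : 0 < b₀) (hlo : ∀ j, j < K → b₀ ≤ β j (prefixOf gs j))
    {k : ℕ} (hk : k < K) :
    S.β1 k (prefixOf gs k) = ∑ i : Fin (k + 1), lam k i * (gs k - gs i) := by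
  rw [β1_eq hβ S hS]
  refine sum_congr rfl fun i _ => ?_
  have hi : (i : ℕ) ≤ k := Nat.lt_succ_iff.1 i.isLt
  have hsign : ∀ j, j < K → 0 ≤ β j (prefixOf gs j) := fun j hj => hb₀.le.trans (hlo j hj)
  have hle : gs i ≤ gs k := run_mono h hpos hsign hi hk.le
  have hgi := hpos i (hi.trans hk.le)
  simp only [prefixOf_apply, Fin.val_last]
  rw [abs_of_nonneg (by linarith), min_eq_right (by linarith)]

/-- **THE REMAINDER ALONG THE RUN IS BOUNDED BELOW, TERMWISE, AT ORDER 0**: with `β ≥ b₀ > 0` along the run,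
`β¹_k(prefix) = Σ_i λ k i·(g_k − g_i) ≥ Σ_i λ k i·g_k·min(1, (k − i)·b₀·g_k²)∕4` (the witness file's `run_sub_ge` termwise) — ONE power of
`g_k` where the order-(AF-1) family has two. [folklore] -/
theorem beta1_prefix_ge
    (hβ : ∀ (k : ℕ) (p : Fin (k + 1) → ℝ),
      β k p = b + ∑ i : Fin (k + 1), lam k i * min (p (Fin.last k)) (|p (Fin.last k) - p i|))
    (S : B12Beta.OneLoopSplit β) (hS : ∀ k, S.β0 k = b) (hlam0 : ∀ (k : ℕ) (i : Fin (k + 1)), 0 ≤ lam k i)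
    {K : ℕ} {gs : ℕ → ℝ} {b₀ : ℝ}
    (h : RGEqH K β gs) (hpos : ∀ k, k ≤ K → 0 < gs k) (hb₀ : 0 < b₀) (hlo : ∀ j, j < K → b₀ ≤ β j (prefixOf gs j))
    {k : ℕ} (hk : k < K) :
    ∑ i : Fin (k + 1), lam k i * (gs k * min 1 (((k : ℝ) - (i : ℕ)) * b₀ * (gs k) ^ 2) / 4) ≤ S.β1 k (prefixOf gs k) := by
  rw [beta1_prefix_eq hβ S hS h hpos hb₀ hlo hk]
  refine sum_le_sum fun i _ => ?_
  have hi : (i : ℕ) ≤ k := Nat.lt_succ_iff.1 i.isLt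
  exact mul_le_mul_of_nonneg_left (run_sub_ge h hpos hb₀ hlo hi hk.le) (hlam0 _ _)

/-- **PROFILE CASE, REFLECTED TO AGES**: for `λ k i = ρ(k − i)` (`ρ ≥ 0`),
`β¹_k(prefix) ≥ (g_k∕4)·Σ_{a<k+1} ρ(a)·min(1, a·b₀·g_k²)` — the shape `RemainderExplicitHistoryLogMomentSharp.beta1_prefix_ge` has with
`g_k²∕4`. [folklore] -/
theorem beta1_prefix_ge_profile
    (hβ : ∀ (k : ℕ) (p : Fin (k + 1) → ℝ),
      β k p = b + ∑ i : Fin (k + 1), ρ (k - (i : ℕ)) * min (p (Fin.last k)) (|p (Fin.last k) - p i|))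
    (S : B12Beta.OneLoopSplit β) (hS : ∀ k, S.β0 k = b) (hρ : ∀ a, 0 ≤ ρ a) {K : ℕ} {gs : ℕ → ℝ} {b₀ : ℝ}
    (h : RGEqH K β gs) (hpos : ∀ k, k ≤ K → 0 < gs k) (hb₀ : 0 < b₀) (hlo : ∀ j, j < K → b₀ ≤ β j (prefixOf gs j))
    {k : ℕ} (hk : k < K) :
    gs k / 4 * ∑ a ∈ range (k + 1), ρ a * min 1 ((a : ℝ) * b₀ * (gs k) ^ 2) ≤ S.β1 k (prefixOf gs k) := by
  have hge := beta1_prefix_ge (lam := fun k i => ρ (k - i)) hβ S hS (fun k i => hρ _) h hpos hb₀ hlo hk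
  refine le_trans (le_of_eq ?_) hge
  -- reflect the age sum into the Fin-sum
  have hrefl : ∑ a ∈ range (k + 1), ρ a * min 1 ((a : ℝ) * b₀ * (gs k) ^ 2) =
      ∑ i : Fin (k + 1), ρ (k - (i : ℕ)) * min 1 ((((k - (i : ℕ) : ℕ)) : ℝ) * b₀ * (gs k) ^ 2) := by
    rw [Fin.sum_univ_eq_sum_range (fun i : ℕ => ρ (k - i) * min 1 ((((k - i : ℕ)) : ℝ) * b₀ * (gs k) ^ 2)) (k + 1)]
    have := sum_range_reflect (fun a : ℕ => ρ a * min 1 ((a : ℝ) * b₀ * (gs k) ^ 2)) (k + 1)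
    simp only [add_tsub_cancel_right] at this
    rw [this]
  rw [hrefl, mul_sum]
  refine sum_congr rfl fun i _ => ?_
  have hi : (i : ℕ) ≤ k := Nat.lt_succ_iff.1 i.isLt
  have hcast : (((k - (i : ℕ) : ℕ)) : ℝ) = (k : ℝ) - (i : ℕ) := by push_cast [Nat.cast_sub hi]; ring
  rw [hcast]
  ring

/-! ## §3 The lower square-root sum -/

/-- ONE STEP: for `x, c > 0`, `(2∕c)·(√(x + c) − √x) ≤ 1∕√x` — from `√(x + c) − √x = c∕(√(x + c) + √x)` and `√(x + c) ≥ √x`.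
[folklore] -/
theorem two_div_mul_sqrt_sub_le {x c : ℝ} (hx : 0 < x) (hc : 0 < c) :
    2 / c * (Real.sqrt (x + c) - Real.sqrt x) ≤ 1 / Real.sqrt x := by
  have hsx : 0 < Real.sqrt x := Real.sqrt_pos.2 hx
  have hsxc : 0 < Real.sqrt (x + c) := Real.sqrt_pos.2 (by linarith)
  have hle : Real.sqrt x ≤ Real.sqrt (x + c) := Real.sqrt_le_sqrt (by linarith)
  have hprod : (Real.sqrt (x + c) - Real.sqrt x) * (Real.sqrt (x + c) + Real.sqrt x) = c := by
    have e1 : Real.sqrt (x + c) * Real.sqrt (x + c) = x + c := Real.mul_self_sqrt (by linarith)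
    have e2 : Real.sqrt x * Real.sqrt x = x := Real.mul_self_sqrt hx.le
    nlinarith
  have hsum : 0 < Real.sqrt (x + c) + Real.sqrt x := by linarith
  have hdiff : Real.sqrt (x + c) - Real.sqrt x = c / (Real.sqrt (x + c) + Real.sqrt x) := by
    rw [eq_div_iff hsum.ne']; exact hprod
  rw [hdiff, div_mul_div_comm, div_le_div_iff₀ (by positivity) hsx]
  nlinarith

/-- **THE LOWER SQUARE-ROOT SUM**: `(2∕c)·(√(P + c(a+1)) − √(P + c)) ≤ Σ_{m<a} 1∕√(P + c(m+1))` for `P, c > 0` — telescoping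
`two_div_mul_sqrt_sub_le` at `x = P + c(m+1)`. [folklore] -/
theorem sum_inv_sqrt_add_mul_ge {P c : ℝ} (hP : 0 < P) (hc : 0 < c) (a : ℕ) :
    2 / c * (Real.sqrt (P + c * ((a : ℝ) + 1)) - Real.sqrt (P + c)) ≤ ∑ m ∈ range a, 1 / Real.sqrt (P + c * ((m : ℝ) + 1)) := by
  have hstep : ∀ m ∈ range a,
      2 / c * (Real.sqrt (P + c * (((m + 1 : ℕ) : ℝ) + 1)) - Real.sqrt (P + c * ((m : ℝ) + 1))) ≤
        1 / Real.sqrt (P + c * ((m : ℝ) + 1)) := by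
    intro m _
    have hm : (0 : ℝ) ≤ m := Nat.cast_nonneg m
    have hxm : 0 < P + c * ((m : ℝ) + 1) := by positivity
    have e : P + c * (((m + 1 : ℕ) : ℝ) + 1) = P + c * ((m : ℝ) + 1) + c := by push_cast; ring
    rw [e]
    exact two_div_mul_sqrt_sub_le hxm hc
  refine le_trans ?_ (sum_le_sum hstep)
  rw [← mul_sum, sum_range_sub (fun m : ℕ => Real.sqrt (P + c * ((m : ℝ) + 1))) a]
  simp

/-! ## §4 The family is genuinely order 0: no order-(AF-1) modulus with bounded weights -/

/-- **THE FAMILY VIOLATES EVERY ORDER-(AF-1) MODULUS WITH BOUNDED WEIGHTS.**  If at some scale `k` a coupling `i₀` other than the last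
carries weight (`λ k i₀ > 0`, `i₀ ≠ k`; `γ > 0`), then for every `W′` there are `p, q` in the box with `p_k = q_k` and
`|β(p) − β(q)| > p_k·W′·Σ_i |p_i − q_i|` — so (M11) of `RemainderExplicitHistoryLogMoment` fails for every weight family bounded by
`W′` (witness: every coupling `ε` except `p_{i₀} = ε∕2`; then `β(p) − β(q) = λ k i₀·ε∕2` against `p_k·W′·Σ|p_i − q_i| = W′ε²∕2`, and
`W′ε < λ k i₀`). [folklore] -/
theorem not_orderOneMemory
    (hβ : ∀ (k : ℕ) (p : Fin (k + 1) → ℝ),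
      β k p = b + ∑ i : Fin (k + 1), lam k i * min (p (Fin.last k)) (|p (Fin.last k) - p i|))
    (hγ : 0 < γ) {k : ℕ} {i₀ : Fin (k + 1)} (hi₀ : i₀ ≠ Fin.last k) (hpos : 0 < lam k i₀) (W' : ℝ) :
    ∃ (p q : Fin (k + 1) → ℝ), p ∈ Box γ k ∧ q ∈ Box γ k ∧ p (Fin.last k) = q (Fin.last k) ∧
      p (Fin.last k) * (W' * ∑ i : Fin (k + 1), |p i - q i|) < |β k p - β k q| := by
  -- ε small: ε ≤ γ and W′·ε < λ k i₀
  obtain ⟨ε, hε0, hεγ, hεW⟩ : ∃ ε : ℝ, 0 < ε ∧ ε ≤ γ ∧ W' * ε < lam k i₀ := by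
    refine ⟨min γ (lam k i₀ / (|W'| + 1)) / 2, by positivity, ?_, ?_⟩
    · linarith [min_le_left γ (lam k i₀ / (|W'| + 1))]
    · have h1 : min γ (lam k i₀ / (|W'| + 1)) / 2 ≤ lam k i₀ / (|W'| + 1) / 2 := by
        linarith [min_le_right γ (lam k i₀ / (|W'| + 1))]
      have hp2 : 0 < min γ (lam k i₀ / (|W'| + 1)) / 2 := by positivity
      calc W' * (min γ (lam k i₀ / (|W'| + 1)) / 2) ≤ |W'| * (min γ (lam k i₀ / (|W'| + 1)) / 2) :=
            mul_le_mul_of_nonneg_right (le_abs_self _) hp2.le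
        _ ≤ |W'| * (lam k i₀ / (|W'| + 1) / 2) := mul_le_mul_of_nonneg_left h1 (abs_nonneg _)
        _ < lam k i₀ := by
            rw [div_div, ← mul_div_assoc, div_lt_iff₀ (by positivity)]
            nlinarith [abs_nonneg W']
  have hne : Fin.last k ≠ i₀ := fun h0 => hi₀ h0.symm
  -- q ≡ ε; p = q with the coordinate i₀ set to ε/2
  refine ⟨Function.update (fun _ => ε) i₀ (ε / 2), fun _ => ε, ?_, ?_, ?_, ?_⟩
  · refine mem_box.2 fun i => ?_
    by_cases hi : i = i₀
    · subst hi; rw [Function.update_self]; constructor <;> linarith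
    · rw [Function.update_of_ne hi]; exact ⟨hε0, hεγ⟩
  · exact mem_box.2 fun _ => ⟨hε0, hεγ⟩
  · rw [Function.update_of_ne hne]
  · -- the sum of |p_i − q_i| is ε/2 (only i = i₀ differs)
    have hsum : ∑ i : Fin (k + 1), |Function.update (fun _ => ε) i₀ (ε / 2) i - ε| = ε / 2 := by
      have e : ∀ i : Fin (k + 1), |Function.update (fun _ => ε) i₀ (ε / 2) i - ε| = if i = i₀ then ε / 2 else 0 := by
        intro i
        by_cases hi : i = i₀
        · subst hi
          rw [if_pos rfl, Function.update_self]
          rw [show ε / 2 - ε = -(ε / 2) by ring, abs_neg, abs_of_pos (half_pos hε0)]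
        · rw [if_neg hi, Function.update_of_ne hi, sub_self, abs_zero]
      rw [sum_congr rfl fun i _ => e i, sum_ite_eq' univ i₀]
      simp
    -- β(p) − β(q) = λ k i₀·ε/2
    have hdiff : β k (Function.update (fun _ => ε) i₀ (ε / 2)) - β k (fun _ => ε) = lam k i₀ * (ε / 2) := by
      rw [hβ, hβ]
      simp only [sub_self, abs_zero, min_eq_right hε0.le, mul_zero, sum_const_zero, add_zero]
      rw [Function.update_of_ne hne]
      have e : ∀ i : Fin (k + 1), lam k i * min ε (|ε - Function.update (fun _ => ε) i₀ (ε / 2) i|) =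
          if i = i₀ then lam k i₀ * (ε / 2) else 0 := by
        intro i
        by_cases hi : i = i₀
        · subst hi
          rw [if_pos rfl, Function.update_self]
          rw [show ε - ε / 2 = ε / 2 by ring, abs_of_pos (half_pos hε0), min_eq_right (by linarith)]
        · rw [if_neg hi, Function.update_of_ne hi, sub_self, abs_zero, min_eq_right hε0.le, mul_zero]
      rw [sum_congr rfl fun i _ => e i, sum_ite_eq' univ i₀]
      simp
    rw [hdiff, hsum, Function.update_of_ne hne, abs_of_pos (by positivity)]
    nlinarith

end Summit.QuantumFields.BalabanUV.Beta.RemainderExplicitHistoryHalfMomentWitness
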